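import Summits.ValiantsHypothesis.ValiantsHypothesis.Theorems.MonotoneRestorationOrbitRestorationQPMatrixAffineMain
import Summits.ValiantsHypothesis.ValiantsHypothesis.Theorems.MonotoneRestorationOrbitRestorationQPSigmaPiSigmaK
import HarnessLib

/-!
# Stub A₁ `stub_piSigmaValue` of line `depth-three-rung` — the ΠΣ sub-rung in value currency — PROVED

Route MonotoneRestoration, crux `OrbitRestorationQP` (stmt-ValiantsHypothesis-18293), line `depth-three-rung`
(skeleton `Cruxes/OrbitRestorationQP/Lines/depth_three_rung.lean`), namespace
`Summit.ValiantsHypothesis.ValiantsHypothesis.Theorems.OrbitRestorationQPDepthThreeRung`.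

**Theorem (`stub_piSigmaValue`, registered signature verbatim).**  Every matrix-symmetric family `f` whose `n`-th
member is (in the product-depth-one slice and) a scalar multiple of a product of at most `n^c + c` polynomials of
total degree `≤ 1` is quasi-polynomially orbit-restorable: `∃ c', ∀ n, QPOrbitRestorable c' n (f n)`.

Proof.  Large `n` (beyond `SigmaKThresholds.chooseThreshold 1 c`, `9` and `4(c+2)`): the constant factors are
absorbed into the scalar, and `MatrixAffine.qpOrbitRestorable_of_matrixSymmetric` (rule M2′: keyed blocks by the
parities of the row/column fibre sign counts, evidence note `A1-M2PRIME-PROOF.md` on the crux item) gives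
`QPOrbitRestorable (2(c+2)+5)`, since `n^c + c < C(n, c+2)` (`SigmaKThresholds.choose_gt_of_le`) and matrix
symmetry supplies the row and column invariance (`ProductAction.rename_prod_eq`); `f n = 0` is a constant.  Small
`n`: every diagonally invariant polynomial is restorable with constant `n! + 5`
(`Restorable.qpOrbitRestorable_of_invariant`).  With the already landed `stub_sigmaPiSigmaKValue` (A_k from A₁ and
the Saxena–Seshadhri rank bound) this closes the bounded-top-fan-in part of the rung `SigmaPiSigmaRestorationQP`;
the crux itself still rests on the limit stub.  VP ≠ VNP is not moved. [folklore]
-/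

noncomputable section

open scoped Classical Pointwise

-- `Summit.ValiantsHypothesis.ValiantsHypothesis.…` is the tree's single-conjunct layout (Sub = Summit).
set_option linter.dupNamespace false

namespace Summit.ValiantsHypothesis.ValiantsHypothesis.Theorems

namespace OrbitRestorationQPDepthThreeRung

open MvPolynomial Equiv Finset ProductAction Literature.Computability.AlgebraicComplexity Restorable SigmaKThresholds
  SigmaPiSigmaK

variable {n : ℕ}

/-- Constant factors of an affine product can be absorbed into the scalar: if every member of `L` has total
degree `≤ 1`, then `a · Π L = (a · b) · Π L₁` where `L₁` are the members of total degree exactly `1` and `b` is the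
product of the constant members. [folklore] -/
theorem affineProd_split (L : Multiset (MvPolynomial (Fin n × Fin n) ℂ)) (a : ℂ)
    (hL : ∀ ℓ ∈ L, ℓ.totalDegree ≤ 1) :
    ∃ b : ℂ, MvPolynomial.C a * L.prod =
      MvPolynomial.C (a * b) * (L.filter fun ℓ => ℓ.totalDegree = 1).prod := by
  have hsplit := Multiset.filter_add_not (fun ℓ : MvPolynomial (Fin n × Fin n) ℂ => ℓ.totalDegree = 1) L
  set L₀ := L.filter fun ℓ => ¬ℓ.totalDegree = 1 with hL₀
  have hconst : ∀ ℓ ∈ L₀, ℓ = MvPolynomial.C (coeff 0 ℓ) := by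
    intro ℓ hℓ
    obtain ⟨hℓL, hne⟩ := Multiset.mem_filter.1 hℓ
    have h0 : ℓ.totalDegree = 0 := by have := hL ℓ hℓL; omega
    exact (totalDegree_eq_zero_iff_eq_C (p := ℓ)).1 h0
  refine ⟨(L₀.map (coeff 0)).prod, ?_⟩
  have hprod₀ : L₀.prod = MvPolynomial.C ((L₀.map (coeff 0)).prod) := by
    rw [map_multiset_prod, Multiset.map_map]
    conv_lhs => rw [← Multiset.map_id L₀]
    exact congrArg Multiset.prod (Multiset.map_congr rfl fun ℓ hℓ => by simpa using hconst ℓ hℓ)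
  conv_lhs => rw [← hsplit, Multiset.prod_add]
  rw [hprod₀, map_mul]
  ring

/-- **Stub A₁ `stub_piSigmaValue` (line `depth-three-rung`, crux `OrbitRestorationQP`), registered signature
verbatim: matrix-symmetric ΠΣ families (scalar multiples of products of polynomially many affine forms) are
quasi-polynomially orbit-restorable.** [folklore; cite: DawarWilsenach2025, §3.3 and Def. 6.1; DixonMortimer1996, Thm 5.2B] -/
theorem stub_piSigmaValue : ∀ f : (n : ℕ) → MvPolynomial (Fin n × Fin n) ℂ, IsMatrixSymmetric f → (∃ c : ℕ, ∀ n : ℕ, PDClass (fun _ => 1) n c (f n) ∧ ∃ (a : ℂ) (L : Multiset (MvPolynomial (Fin n × Fin n) ℂ)), (∀ ℓ ∈ L, ℓ.totalDegree ≤ 1) ∧ Multiset.card L ≤ n ^ c + c ∧ f n = MvPolynomial.C a * L.prod) → ∃ c : ℕ, ∀ n : ℕ, QPOrbitRestorable c n (f n) := by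
  intro f hsym hf
  obtain ⟨c, hc⟩ := hf
  set N₀ : ℕ := max (chooseThreshold 1 c) (max 9 (4 * (c + 2))) with hN₀
  -- large levels
  have hbig : ∀ n, N₀ ≤ n → QPOrbitRestorable (2 * (c + 2) + 5) n (f n) := by
    intro n hn
    have hn1 : chooseThreshold 1 c ≤ n := le_trans (le_max_left _ _) hn
    have hn9 : 8 < n := by have := le_trans (le_max_right _ _) hn; omega
    have hn4 : 4 * (c + 2) ≤ n := by have := le_trans (le_max_right _ _) hn; omega
    obtain ⟨-, a, L, hL, hcard, hfn⟩ := hc n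
    by_cases hf0 : f n = 0
    · rw [hf0, ← MvPolynomial.C_0]
      exact qpOrbitRestorable_mono (by omega) (qpOrbitRestorable_C 0)
    obtain ⟨b, hb⟩ := affineProd_split L a hL
    set L₁ := L.filter fun ℓ => ℓ.totalDegree = 1 with hL₁
    rw [hb] at hfn
    have hL1 : ∀ ℓ ∈ L₁, ℓ.totalDegree = 1 := fun ℓ hℓ => (Multiset.mem_filter.1 hℓ).2
    have hcard1 : Multiset.card L₁ < n.choose (c + 2) := by
      have h1 := Multiset.card_le_card (Multiset.filter_le (fun ℓ : MvPolynomial (Fin n × Fin n) ℂ =>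
        ℓ.totalDegree = 1) L)
      have h2 := choose_gt_of_le hn1
      rw [one_mul] at h2
      exact lt_of_le_of_lt (h1.trans hcard) h2
    have hf0' : MvPolynomial.C (a * b) * L₁.prod ≠ 0 := by rw [← hfn]; exact hf0
    have hrow : ∀ σ : Perm (Fin n), vact (K := ℂ) rowHom σ (MvPolynomial.C (a * b) * L₁.prod) =
        MvPolynomial.C (a * b) * L₁.prod := by
      intro σ
      have h := hsym n σ 1
      rw [rename_prod_eq, map_one, AlgEquiv.one_apply, hfn] at h
      exact h
    have hcol : ∀ τ : Perm (Fin n), vact (K := ℂ) colHom τ (MvPolynomial.C (a * b) * L₁.prod) =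
        MvPolynomial.C (a * b) * L₁.prod := by
      intro τ
      have h := hsym n 1 τ
      rw [rename_prod_eq, map_one, AlgEquiv.one_apply, hfn] at h
      exact h
    rw [hfn]
    exact MatrixAffine.qpOrbitRestorable_of_matrixSymmetric (k := c + 2) hn9 (by omega) hn4 L₁ (a * b) hL1 hcard1
      hf0' hrow hcol
  -- small levels
  have hsmall : ∀ n, n < N₀ → QPOrbitRestorable (N₀.factorial + 5) n (f n) := fun n hn =>
    qpOrbitRestorable_mono (Nat.add_le_add_right (Nat.factorial_le hn.le) 5)
      (qpOrbitRestorable_of_invariant (f n) (ren_eq_of_matrixSymmetric hsym n))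
  refine ⟨max (2 * (c + 2) + 5) (N₀.factorial + 5), fun n => ?_⟩
  by_cases hn : N₀ ≤ n
  · exact qpOrbitRestorable_mono (le_max_left _ _) (hbig n hn)
  · exact qpOrbitRestorable_mono (le_max_right _ _) (hsmall n (not_le.1 hn))

/-- **The bounded-top-fan-in rung, unconditionally in A₁.**  With A₁ proved, the landed reduction
`stub_sigmaPiSigmaKValue` (A_k from A₁ and the Saxena–Seshadhri rank bound, taken by name) gives: for every `k`,
assuming `depthThree_rankBound`, every matrix-symmetric family whose members are sums of `k` scalar multiples of
products of at most `n^c + c` affine forms is quasi-polynomially orbit-restorable. [cite: SaxenaSeshadhri2013, Theorem 5; DawarWilsenach2025, §3.3] -/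
theorem sigmaPiSigmaKValue_of_rankBound (k : ℕ)
    (hRB : Literature.Computability.AlgebraicComplexity.depthThree_rankBound) :
    ∀ f : (n : ℕ) → MvPolynomial (Fin n × Fin n) ℂ, IsMatrixSymmetric f →
      (∃ c : ℕ, ∀ n : ℕ, PDClass (fun _ => 1) n c (f n) ∧
        ∃ (a : Fin k → ℂ) (L : Fin k → Multiset (MvPolynomial (Fin n × Fin n) ℂ)),
          (∀ i, ∀ ℓ ∈ L i, ℓ.totalDegree ≤ 1) ∧ (∀ i, Multiset.card (L i) ≤ n ^ c + c) ∧
          f n = ∑ i, MvPolynomial.C (a i) * (L i).prod) →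
      ∃ c : ℕ, ∀ n : ℕ, QPOrbitRestorable c n (f n) :=
  stub_sigmaPiSigmaKValue k hRB stub_piSigmaValue

end OrbitRestorationQPDepthThreeRung

end Summit.ValiantsHypothesis.ValiantsHypothesis.Theorems

end
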